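import Summits.CriticalPhenomena.Ising3D.TaylorKernelPDDelta
import Summits.CriticalPhenomena.Ising3D.TaylorRegionTableRows
import Mathlib.Tactic.Linarith
import Mathlib.Tactic.Positivity
import Mathlib.Tactic.Ring
import HarnessLib

/-!
# δ-expanded region ROWS: every q-sum over a box `s ∈ [s₀ − W, s₀ + W]` is a TRIPLE of table rows, and a positivity
checker for such triples (item (L3a) of the box-width-robust region rows; HOME/pub-ising3x-recog-1/gen12/REGION-ON-MARGIN-FUNCTIONAL.md §5)
(cell `pub-ising3x`, seat recog-1 gen 12; gate (g2))

HONEST FRAMING: lottery ticket; floor = tightest certified 3D Ising CFT bounds; no exact-solution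
claim without a proof. Island framing: certified exclusion region at stated derivative order and
assumptions; not a determination of the 3D Ising critical exponents beyond that.

From `TaylorKernelPDDelta` (`K[s₀+δ] = eval2 T₀ + δ eval2 T₁ + δ² eval2 T₂(δ)`): (1) the q-sum at integer `j` from ANY table
whose `eval2` is the kernel (`qSum_eq_evalR_qRowOfTable_of_eval2`, the generic form of the tree's `qSum_eq_evalR_qRowOfTable`);
(2) linearity of `qRowOfTable` over `add2` / `smul2`; (3) **`qSum_eq_delta_rows`**: for `s = s₀ + δ`,
`q̂(E, j; s) = R₀(E−cc) + δ R₁(E−cc) + δ² R₂(δ)(E−cc)` with `R_m = qRowOfTable T_mᴿ N j`, memberships of the three rows in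
`qRowOfTableI (deltaT_m …) N j` (`R₂` in the interval row of `deltaT2` for every `|δ| ≤ W`), the size side condition as the
Boolean `deltaSizeOK`; the piece bounds and the triple checkers (`lowB`/`absB`, `posCore3`/`posOn3`, `posCoreDE3`/`posOnDE3`, `rowPos3`) are in
`TaylorRegionDeltaPieces`; the literal-triple row Booleans, the tails and the region assembly are item (L3b). Elementary. [folklore]
-/

namespace Summit.CriticalPhenomena.Ising3D

open Finset
open Literature.Analysis.ValidatedNumerics Literature.Analysis.ValidatedNumerics.PolyMP
open Literature.Analysis.ValidatedNumerics.NumericsMP (MI)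
open Literature.MathematicalPhysics.QuantumFieldTheory.ConformalBootstrap3D

/-! ### (1) q-sums from any table whose `eval2` is the kernel -/

/-- **Generic row form**: if `eval2 Q (u+v−cc) (u−v) = K_c[s](u,v)` identically and `size2 Q ≤ N`, then
`q̂(E, j) = evalR (qRowOfTable Q N j) (E − cc)`. [folklore] -/
theorem qSum_eq_evalR_qRowOfTable_of_eval2 (c : ℕ × ℕ → ℝ) (S : Finset (ℕ × ℕ)) (s σ cc : ℝ) (Q : List (List ℝ))
    (hQ : ∀ u v : ℝ, eval2 Q (u + v - cc) (u - v) = evenKernel c S s σ u v) {N : ℕ} (hN : size2 Q ≤ N) (E : ℝ) (j : ℕ) :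
    qSum c S s σ E j = evalR (qRowOfTable Q N j) (E - cc) := by
  have hK := fun u v => sum_PD_of_eval2 Q (evenKernel c S s σ) cc hQ u v
  rw [qSum_eq_sum_hMoment_of_kernel c S s σ cc _ _ _ _ hK E j, evalR_qRowOfTable, Finset.sum_product_right]
  have hrow : ∀ k : ℕ, ∑ m ∈ range (size2 Q), coeff2 Q m (2 * k) * ((E - cc) ^ m * hMoment k j) =
      evalR (Q.getD (2 * k) []) (E - cc) * hMoment k j := by
    intro k
    rw [evalR_eq_sum_pad (Q.getD (2 * k) []) (length_getD_le_size2 Q (2 * k)), Finset.sum_mul]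
    exact Finset.sum_congr rfl fun m _ => by rw [coeff2]; ring
  simp_rw [hrow]
  refine Finset.sum_subset (range_subset_range.2 hN) fun k hk hk' => ?_
  have hk2 : size2 Q ≤ 2 * k := by simp only [Finset.mem_range, not_lt] at hk hk'; omega
  rw [List.getD_eq_default _ _ ((length_le_size2 Q).trans hk2), evalR_nil, zero_mul]

/-! ### (2) `qRowOfTable` is linear in the table -/

/-- [folklore] -/
theorem addR_nil_right : ∀ as : List ℝ, addR as [] = as
  | [] => rfl
  | _ :: _ => rfl

/-- [folklore] -/
theorem getD_add2 : ∀ (A B : List (List ℝ)) (k : ℕ), (add2 A B).getD k [] = addR (A.getD k []) (B.getD k [])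
  | [], B, k => by rw [List.getD_nil]; rfl
  | p :: P, [], k => by
      rw [List.getD_nil, addR_nil_right]; rfl
  | p :: P, q :: Q, 0 => rfl
  | p :: P, q :: Q, k + 1 => by
      rw [List.getD_cons_succ, List.getD_cons_succ, ← getD_add2 P Q k]; rfl

/-- [folklore] -/
theorem getD_smul2 (c : ℝ) (Q : List (List ℝ)) (k : ℕ) : (smul2 c Q).getD k [] = smulR c (Q.getD k []) := by
  rw [smul2]
  have h := List.getD_map (l := Q) (n := k) (d := ([] : List ℝ)) (smulR c)
  simpa [smulR] using h

/-- [folklore] -/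
theorem evalR_qRowOfTable_add2 (A B : List (List ℝ)) (N j : ℕ) (P : ℝ) :
    evalR (qRowOfTable (add2 A B) N j) P = evalR (qRowOfTable A N j) P + evalR (qRowOfTable B N j) P := by
  simp only [evalR_qRowOfTable, getD_add2, evalR_addR, add_mul, sum_add_distrib]

/-- [folklore] -/
theorem evalR_qRowOfTable_smul2 (c : ℝ) (Q : List (List ℝ)) (N j : ℕ) (P : ℝ) :
    evalR (qRowOfTable (smul2 c Q) N j) P = c * evalR (qRowOfTable Q N j) P := by
  simp only [evalR_qRowOfTable, getD_smul2, evalR_smulR, mul_assoc, mul_sum]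

/-! ### (3) The q-sum over a box as a triple of rows -/

/-- The full interval table `T₀ + [−W,W]·T₁ + [0,W²]·T₂` (only its SIZE is used by the kernel). [folklore] -/
def deltaTfull (S : ℕ) (cQ : ℕ × ℕ → ℚ) (σQ : ℚ) (s₀ W ccQ : ℚ) (l : List (ℕ × ℕ)) : IPoly2 :=
  add2I (deltaT0 S cQ σQ s₀ ccQ l)
    (add2I (smul2MI S (enclQ S (-W) W) (deltaT1 S cQ σQ s₀ ccQ l))
      (smul2MI S (enclQ S 0 (W ^ 2)) (deltaT2 S cQ σQ s₀ W ccQ l)))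

/-- Its real shadow at a given `δ`. [folklore] -/
noncomputable def deltaQfull (cQ : ℕ × ℕ → ℚ) (σQ : ℚ) (s₀ ccQ : ℚ) (l : List (ℕ × ℕ)) (δ : ℝ) : List (List ℝ) :=
  add2 (deltaT0R cQ σQ s₀ ccQ l)
    (add2 (smul2 δ (deltaT1R cQ σQ s₀ ccQ l)) (smul2 (δ ^ 2) (deltaT2R cQ σQ s₀ ccQ l δ)))

/-- Size side condition of the δ-tables. [folklore] -/
def deltaSizeOK (S : ℕ) (cQ : ℕ × ℕ → ℚ) (σQ : ℚ) (s₀ W ccQ : ℚ) (l : List (ℕ × ℕ)) (N : ℕ) : Bool :=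
  decide (size2I (deltaTfull S cQ σQ s₀ W ccQ l) ≤ N)

/-- [folklore] -/
theorem pmem2_deltaQfull {S : ℕ} (hS : 0 < S) (cQ : ℕ × ℕ → ℚ) (σQ : ℚ) (s₀ : ℚ) {W : ℚ} (hW : 0 ≤ W) (ccQ : ℚ)
    (l : List (ℕ × ℕ)) {δ : ℝ} (hδ : |δ| ≤ W) :
    PMem2 S (deltaQfull cQ σQ s₀ ccQ l δ) (deltaTfull S cQ σQ s₀ W ccQ l) := by
  have hδI : MI.mem S δ (enclQ S (-W) W) :=
    mem_enclQ S (by push_cast; linarith [neg_abs_le δ, hδ, (abs_le.mp hδ).1]) (by linarith [le_abs_self δ])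
  have hδ2 : MI.mem S (δ ^ 2) (enclQ S 0 (W ^ 2)) := by
    refine mem_enclQ S (by push_cast; positivity) ?_
    have : δ ^ 2 ≤ (W : ℝ) ^ 2 := by
      rw [← sq_abs]; exact pow_le_pow_left₀ (abs_nonneg δ) hδ 2
    exact_mod_cast this
  exact pmem2_add2I (pmem2_deltaT0 hS cQ σQ s₀ ccQ l)
    (pmem2_add2I (pmem2_smul2MI hS hδI (pmem2_deltaT1 hS cQ σQ s₀ ccQ l))
      (pmem2_smul2MI hS hδ2 (pmem2_deltaT2 hS cQ σQ s₀ hW ccQ l hδ)))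

/-- **The q-sum over the box as a triple of rows**: for `s = s₀ + δ`, `|δ| ≤ W`, duplicate-free `l` and `deltaSizeOK`,
`q̂(E, j; s) = R₀(E − cc) + δ·R₁(E − cc) + δ²·R₂(δ)(E − cc)`, `R_m = qRowOfTable T_mᴿ N j`. [folklore] -/
theorem qSum_eq_delta_rows {S : ℕ} (hS : 0 < S) (cQ : ℕ × ℕ → ℚ) (σQ : ℚ) (s₀ : ℚ) {W : ℚ} (hW : 0 ≤ W) (ccQ : ℚ)
    {l : List (ℕ × ℕ)} (hl : l.Nodup) {N : ℕ} (hN : deltaSizeOK S cQ σQ s₀ W ccQ l N = true) {δ : ℝ} (hδ : |δ| ≤ W)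
    (E : ℝ) (j : ℕ) :
    qSum (fun ab => (cQ ab : ℝ)) l.toFinset ((s₀ : ℝ) + δ) (σQ : ℝ) E j =
      evalR (qRowOfTable (deltaT0R cQ σQ s₀ ccQ l) N j) (E - ccQ) +
        δ * evalR (qRowOfTable (deltaT1R cQ σQ s₀ ccQ l) N j) (E - ccQ) +
          δ ^ 2 * evalR (qRowOfTable (deltaT2R cQ σQ s₀ ccQ l δ) N j) (E - ccQ) := by
  have hsize : size2 (deltaQfull cQ σQ s₀ ccQ l δ) ≤ N := by
    rw [size2_eq_of_pmem2 (pmem2_deltaQfull hS cQ σQ s₀ hW ccQ l hδ)]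
    exact of_decide_eq_true hN
  have hQ : ∀ u v : ℝ, eval2 (deltaQfull cQ σQ s₀ ccQ l δ) (u + v - ccQ) (u - v) =
      evenKernel (fun ab => (cQ ab : ℝ)) l.toFinset ((s₀ : ℝ) + δ) (σQ : ℝ) u v := fun u v => by
    rw [evenKernel_eq_eval2_delta cQ σQ s₀ ccQ hl δ u v, deltaQfull, eval2_add2, eval2_add2, eval2_smul2, eval2_smul2]
    ring
  rw [qSum_eq_evalR_qRowOfTable_of_eval2 _ _ _ _ _ _ hQ hsize E j, deltaQfull, evalR_qRowOfTable_add2,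
    evalR_qRowOfTable_add2, evalR_qRowOfTable_smul2, evalR_qRowOfTable_smul2]
  ring

/-- Memberships of the three real rows in the kernel's interval rows. [folklore] -/
theorem pmem_delta_rows {S : ℕ} (hS : 0 < S) (cQ : ℕ × ℕ → ℚ) (σQ : ℚ) (s₀ : ℚ) {W : ℚ} (hW : 0 ≤ W) (ccQ : ℚ)
    (l : List (ℕ × ℕ)) (N j : ℕ) {δ : ℝ} (hδ : |δ| ≤ W) :
    PMem S (qRowOfTable (deltaT0R cQ σQ s₀ ccQ l) N j) (qRowOfTableI (deltaT0 S cQ σQ s₀ ccQ l) N j) ∧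
      PMem S (qRowOfTable (deltaT1R cQ σQ s₀ ccQ l) N j) (qRowOfTableI (deltaT1 S cQ σQ s₀ ccQ l) N j) ∧
        PMem S (qRowOfTable (deltaT2R cQ σQ s₀ ccQ l δ) N j) (qRowOfTableI (deltaT2 S cQ σQ s₀ W ccQ l) N j) :=
  ⟨pmem_qRowOfTableI (pmem2_deltaT0 hS cQ σQ s₀ ccQ l) N j, pmem_qRowOfTableI (pmem2_deltaT1 hS cQ σQ s₀ ccQ l) N j,
    pmem_qRowOfTableI (pmem2_deltaT2 hS cQ σQ s₀ hW ccQ l hδ) N j⟩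

end Summit.CriticalPhenomena.Ising3D
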